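import Mathlib
import HarnessLib
import Summits.HubbardSuperconductivity.HubbardSuperconductivity.Theorems.KLProgrammeKLRegimeTwoVolumeSourceReadout

/-!
# Route `KLProgramme` — crux K3, VL child (stmt-HubbardSuperconductivity-20440), keying «(VL)-SRC-WINDOW» (R227)/(R236) (β), lemma (N2):
# A MULTIPLIER FAMILY REALISED BY A TIME SMOOTHING — the `F`-dressed two-leg kernel is the doubly time-smoothed plain kernel, so its weighted far rows cost
# only the `ℓ¹` constants of the smoothing (generic in the smoothing kernel `S` and the family `F`)

Cell gate-hubbard-kl, seat p1 g22.  k3c4-p1's window key reads the source legs through `E(F_χ)`, `F_χ 0 k = w_{k₀}`, and `w` is realised by the time kernel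
`W_c(τ,τ′) = srcSmoothKernel M c τ τ′`: `Σ_{τ′} W_c(τ,τ′)·e_c(k;(τ′,x⃗)) = w_{k₀}·e_c(k;(τ,x⃗))` (`…TwoVolumeSourceSmoothAnalysis.sum_srcSmoothKernel_mul_hubbardPlaneWave`),
with `M`-uniform `ℓ¹` rows/columns (`…SourceSmoothKit.exists_srcSmoothKernel_l1_bound`).  Here, for ANY `S : Fin 2 → ImagTimeIdx M → ImagTimeIdx M → ℂ` and one-sector
family `F` tied by that eigen-relation (`hS`):
* §1 **`sectorisedKernel_family_two_eq_smooth`** — `W^F_G(x₀,x₁) = Σ_{τ₀′,τ₁′} S_{c₀}(t₀,τ₀′)·S_{c₁}(t₁,τ₁′)·W_G((τ₀′,x⃗₀),(τ₁′,x⃗₁))` (degree 2, any legs/charges, any `G`);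
* §2 **`weightedRows_family_le_of_smooth`** — for a pin `o`, a set of spatial offsets `Sy` and spatial weights `w ≥ 0`:
  `Σ_{t₁} Σ_{y ∈ Sy} w(y)·‖W^F_G(o,(t₁,o⃗+y))‖ ≤ C_row·C_col·B` whenever `Σ_{τ′}‖S_c(τ,τ′)‖ ≤ C_row`, `Σ_{τ}‖S_c(τ,τ′)‖ ≤ C_col` and the PLAIN rows obey
  `Σ_{τ₁′} Σ_{y ∈ Sy} w(y)·‖W_G((τ₀′,o⃗),(τ₁′,o⃗+y))‖ ≤ B` at every time `τ₀′` — so the far rows / the weighted far rows of the windowed kernels are paid by the plain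
  token-#24 datum `klSrcPinnedSum` (`…TwoVolumeSourceReadout.weightedRows_le_klSrcPinnedSum`, every pin) times `C_W²`.

Proofs only; no definition; nothing asserts HB1W, (β), any VL stub, K3 or superconductivity.
References: BGM 2006 §2.9 (4.6)–(4.8) [cite: BenfattoGiulianiMastropietro2006]; Salmhofer 1999 App. B.5.5 [cite: Salmhofer1999].
-/

noncomputable section

namespace Summit.HubbardSuperconductivity.HubbardSuperconductivity.Theorems.TwoVolumeSource

set_option linter.dupNamespace false -- summit = problem name (single-conjunct summit), D-0017

open Finset Literature.MathematicalPhysics.QuantumLattice Literature.Probability.LatticeModels GrassmannAlgebra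
open Summit.HubbardSuperconductivity.HubbardSuperconductivity.Theorems.KLProgrammeLegKernels
open Summit.HubbardSuperconductivity.HubbardSuperconductivity.Theorems.KLRegimeSplit
open Summit.HubbardSuperconductivity.HubbardSuperconductivity.Theorems.TwoVolumeDefect

variable {L M : ℕ} [NeZero L]

/-! ## §1 The `F`-dressed two-leg kernel is the doubly smoothed plain kernel -/

/-- **`W^F_G(x₀,x₁) = Σ_{τ₀′,τ₁′} S_{c₀}(t₀,τ₀′)·S_{c₁}(t₁,τ₁′)·W_G((τ₀′,x⃗₀),(τ₁′,x⃗₁))`** for a one-sector family `F` realised by the time smoothing `S`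
(`Σ_{τ′} S_c(τ,τ′)·e_c(k;(τ′,x⃗)) = F₀(k)·e_c(k;(τ,x⃗))`). [cite: Salmhofer1999, App. B.5.5] -/
theorem sectorisedKernel_family_two_eq_smooth (β : ℝ) (S : Fin 2 → ImagTimeIdx M → ImagTimeIdx M → ℂ) (F : Fin 1 → FreqMomentum L M → ℂ)
    (hS : ∀ (c : Fin 2) (k : FreqMomentum L M) (τ : ImagTimeIdx M) (x : TorusSite 2 L),
      ∑ τ' : ImagTimeIdx M, S c τ τ' * hubbardPlaneWave L M β c k (τ', x) = F 0 k * hubbardPlaneWave L M β c k (τ, x))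
    (G : HubbardGrassmann L M) (Ω : Fin 2 → SectorLeg 1) (x : Fin 2 → SpaceTimeIdx L M) :
    sectorisedKernel L M β F G 2 Ω x =
      ∑ τ₀ : ImagTimeIdx M, ∑ τ₁ : ImagTimeIdx M, S (Ω 0).2 (x 0).1 τ₀ * S (Ω 1).2 (x 1).1 τ₁ *
        sectorisedKernel L M β (trivialMultiplier L M) G 2 Ω ![(τ₀, (x 0).2), (τ₁, (x 1).2)] := by
  have hΩ : ∀ i, (Ω i).1.1 = 0 := fun i => Subsingleton.elim _ _
  -- the leg factor of the `F`-kernel at momenta `k`, as the double time sum of the plain leg factors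
  have key : ∀ k : Fin 2 → FreqMomentum L M,
      (∏ i, F (Ω i).1.1 (k i) * hubbardPlaneWave L M β (Ω i).2 (k i) (x i)) =
        ∑ τ₀ : ImagTimeIdx M, ∑ τ₁ : ImagTimeIdx M, S (Ω 0).2 (x 0).1 τ₀ * S (Ω 1).2 (x 1).1 τ₁ *
          ∏ i, trivialMultiplier L M (Ω i).1.1 (k i) * hubbardPlaneWave L M β (Ω i).2 (k i) ((![(τ₀, (x 0).2), (τ₁, (x 1).2)] : Fin 2 → SpaceTimeIdx L M) i) := by
    intro k
    simp only [Fin.prod_univ_two, Matrix.cons_val_zero, Matrix.cons_val_one, trivialMultiplier, one_mul, hΩ]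
    have h0 := hS (Ω 0).2 (k 0) (x 0).1 (x 0).2
    have h1 := hS (Ω 1).2 (k 1) (x 1).1 (x 1).2
    have e : (∑ τ₀ : ImagTimeIdx M, ∑ τ₁ : ImagTimeIdx M, S (Ω 0).2 (x 0).1 τ₀ * S (Ω 1).2 (x 1).1 τ₁ *
        (hubbardPlaneWave L M β (Ω 0).2 (k 0) (τ₀, (x 0).2) * hubbardPlaneWave L M β (Ω 1).2 (k 1) (τ₁, (x 1).2))) =
        (∑ τ₀ : ImagTimeIdx M, S (Ω 0).2 (x 0).1 τ₀ * hubbardPlaneWave L M β (Ω 0).2 (k 0) (τ₀, (x 0).2)) *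
          ∑ τ₁ : ImagTimeIdx M, S (Ω 1).2 (x 1).1 τ₁ * hubbardPlaneWave L M β (Ω 1).2 (k 1) (τ₁, (x 1).2) := by
      rw [Finset.sum_mul_sum]
      refine sum_congr rfl fun τ₀ _ => sum_congr rfl fun τ₁ _ => by ring
    rw [e, h0, h1]
  rw [sectorisedKernel_def]
  simp_rw [key, sum_mul]
  -- RHS: pull the momentum sum outside the two time sums
  simp only [sectorisedKernel_def, mul_sum]
  rw [Finset.sum_comm]
  refine sum_congr rfl fun τ₀ _ => ?_
  rw [Finset.sum_comm]
  refine sum_congr rfl fun τ₁ _ => sum_congr rfl fun k _ => ?_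
  ring

/-! ## §2 Weighted far rows of the `F`-kernel from the plain ones -/

/-- Reordering a four-fold finite sum: `Σ_a Σ_b Σ_c Σ_d = Σ_c Σ_d Σ_a Σ_b`. [folklore] -/
private theorem sum_four_comm {α β' γ δ : Type*} (A : Finset α) (B : Finset β') (C : Finset γ) (D : Finset δ) (f : α → β' → γ → δ → ℝ) :
    ∑ a ∈ A, ∑ b ∈ B, ∑ c ∈ C, ∑ d ∈ D, f a b c d = ∑ c ∈ C, ∑ d ∈ D, ∑ a ∈ A, ∑ b ∈ B, f a b c d := by
  calc ∑ a ∈ A, ∑ b ∈ B, ∑ c ∈ C, ∑ d ∈ D, f a b c d = ∑ a ∈ A, ∑ c ∈ C, ∑ b ∈ B, ∑ d ∈ D, f a b c d :=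
        Finset.sum_congr rfl fun a _ => Finset.sum_comm
    _ = ∑ c ∈ C, ∑ a ∈ A, ∑ b ∈ B, ∑ d ∈ D, f a b c d := Finset.sum_comm
    _ = ∑ c ∈ C, ∑ a ∈ A, ∑ d ∈ D, ∑ b ∈ B, f a b c d :=
        Finset.sum_congr rfl fun c _ => Finset.sum_congr rfl fun a _ => Finset.sum_comm
    _ = ∑ c ∈ C, ∑ d ∈ D, ∑ a ∈ A, ∑ b ∈ B, f a b c d := Finset.sum_congr rfl fun c _ => Finset.sum_comm

/-- **WEIGHTED ROWS OF THE SMOOTHED KERNEL** (pin `o`, spatial offsets `Sy`, spatial weights `w ≥ 0`; `S` with `ℓ¹` rows `≤ C_row` and columns `≤ C_col`):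
`Σ_{t₁} Σ_{y ∈ Sy} w(y)·‖W^F_G(o,(t₁,o⃗+y))‖ ≤ C_row·C_col·B` once the PLAIN rows obey `Σ_{τ₁′} Σ_{y ∈ Sy} w(y)·‖W_G((τ₀′,o⃗),(τ₁′,o⃗+y))‖ ≤ B` at every time `τ₀′`.
[cite: BenfattoGiulianiMastropietro2006, §2.9 (4.6)-(4.8)] -/
theorem weightedRows_family_le_of_smooth (β : ℝ) (S : Fin 2 → ImagTimeIdx M → ImagTimeIdx M → ℂ) (F : Fin 1 → FreqMomentum L M → ℂ)
    (hS : ∀ (c : Fin 2) (k : FreqMomentum L M) (τ : ImagTimeIdx M) (x : TorusSite 2 L),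
      ∑ τ' : ImagTimeIdx M, S c τ τ' * hubbardPlaneWave L M β c k (τ', x) = F 0 k * hubbardPlaneWave L M β c k (τ, x))
    {Crow Ccol : ℝ} (hrow : ∀ (c : Fin 2) (τ : ImagTimeIdx M), ∑ τ' : ImagTimeIdx M, ‖S c τ τ'‖ ≤ Crow)
    (hcol : ∀ (c : Fin 2) (τ' : ImagTimeIdx M), ∑ τ : ImagTimeIdx M, ‖S c τ τ'‖ ≤ Ccol)
    (G : HubbardGrassmann L M) (Ω : Fin 2 → SectorLeg 1) (o : SpaceTimeIdx L M) (Sy : Finset (TorusSite 2 L)) {w : TorusSite 2 L → ℝ}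
    (hw : ∀ y, 0 ≤ w y) {B : ℝ}
    (hB : ∀ τ₀ : ImagTimeIdx M, ∑ τ₁ : ImagTimeIdx M, ∑ y ∈ Sy, w y *
      ‖sectorisedKernel L M β (trivialMultiplier L M) G 2 Ω ![(τ₀, o.2), (τ₁, o.2 + y)]‖ ≤ B) :
    ∑ t₁ : ImagTimeIdx M, ∑ y ∈ Sy, w y * ‖sectorisedKernel L M β F G 2 Ω ![o, (t₁, o.2 + y)]‖ ≤ Crow * Ccol * B := by
  -- shorthand for the plain kernel at times `(τ₀, τ₁)` and offset `y`
  set Wp : ImagTimeIdx M → ImagTimeIdx M → TorusSite 2 L → ℂ := fun τ₀ τ₁ y =>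
    sectorisedKernel L M β (trivialMultiplier L M) G 2 Ω ![(τ₀, o.2), (τ₁, o.2 + y)] with hWp
  have hCrow : 0 ≤ Crow := le_trans (Finset.sum_nonneg fun τ' _ => norm_nonneg (S (Ω 0).2 o.1 τ')) (hrow (Ω 0).2 o.1)
  have hCcol : 0 ≤ Ccol := le_trans (Finset.sum_nonneg fun τ _ => norm_nonneg (S (Ω 1).2 τ o.1)) (hcol (Ω 1).2 o.1)
  have hB0 : 0 ≤ B := le_trans (Finset.sum_nonneg fun τ₁ _ => Finset.sum_nonneg fun y _ => mul_nonneg (hw y)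
    (norm_nonneg (sectorisedKernel L M β (trivialMultiplier L M) G 2 Ω ![(o.1, o.2), (τ₁, o.2 + y)]))) (hB o.1)
  -- termwise: `‖W^F(o,(t₁,o⃗+y))‖ ≤ Σ_{τ₀,τ₁} ‖S₀(t₀,τ₀)‖‖S₁(t₁,τ₁)‖‖W((τ₀,o⃗),(τ₁,o⃗+y))‖`
  have hterm : ∀ (t₁ : ImagTimeIdx M) (y : TorusSite 2 L),
      ‖sectorisedKernel L M β F G 2 Ω ![o, (t₁, o.2 + y)]‖ ≤
        ∑ τ₀ : ImagTimeIdx M, ∑ τ₁ : ImagTimeIdx M, ‖S (Ω 0).2 o.1 τ₀‖ * ‖S (Ω 1).2 t₁ τ₁‖ * ‖Wp τ₀ τ₁ y‖ := by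
    intro t₁ y
    rw [sectorisedKernel_family_two_eq_smooth β S F hS G Ω]
    simp only [Matrix.cons_val_zero, Matrix.cons_val_one, hWp]
    refine (norm_sum_le _ _).trans (sum_le_sum fun τ₀ _ => (norm_sum_le _ _).trans (sum_le_sum fun τ₁ _ => ?_))
    rw [norm_mul, norm_mul]
  -- sum the termwise bound, reorder to `Σ_{τ₀} Σ_{τ₁} Σ_{t₁} Σ_y`, factor, and use the `ℓ¹` bounds and the plain rows
  have h1 : ∑ t₁ : ImagTimeIdx M, ∑ y ∈ Sy, w y * ‖sectorisedKernel L M β F G 2 Ω ![o, (t₁, o.2 + y)]‖ ≤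
      ∑ t₁ : ImagTimeIdx M, ∑ y ∈ Sy, ∑ τ₀ : ImagTimeIdx M, ∑ τ₁ : ImagTimeIdx M,
        w y * (‖S (Ω 0).2 o.1 τ₀‖ * ‖S (Ω 1).2 t₁ τ₁‖ * ‖Wp τ₀ τ₁ y‖) := by
    refine sum_le_sum fun t₁ _ => sum_le_sum fun y _ => ?_
    have h := mul_le_mul_of_nonneg_left (hterm t₁ y) (hw y)
    simpa only [Finset.mul_sum] using h
  refine h1.trans ?_
  rw [sum_four_comm]
  -- per `(τ₀, τ₁)`: `Σ_{t₁} Σ_y w·‖a‖‖b‖‖c‖ = ‖a τ₀‖ · (Σ_{t₁}‖b t₁ τ₁‖) · (Σ_y w‖c‖)`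
  have h2 : ∀ τ₀ τ₁ : ImagTimeIdx M, ∑ t₁ : ImagTimeIdx M, ∑ y ∈ Sy, w y * (‖S (Ω 0).2 o.1 τ₀‖ * ‖S (Ω 1).2 t₁ τ₁‖ * ‖Wp τ₀ τ₁ y‖) =
      ‖S (Ω 0).2 o.1 τ₀‖ * ((∑ t₁ : ImagTimeIdx M, ‖S (Ω 1).2 t₁ τ₁‖) * ∑ y ∈ Sy, w y * ‖Wp τ₀ τ₁ y‖) := by
    intro τ₀ τ₁
    rw [Finset.sum_mul_sum, mul_sum]
    refine sum_congr rfl fun t₁ _ => ?_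
    rw [mul_sum]
    refine sum_congr rfl fun y _ => by ring
  simp_rw [h2, ← mul_sum]
  -- the bounds
  have h3 : ∀ τ₀ : ImagTimeIdx M, ∑ τ₁ : ImagTimeIdx M, (∑ t₁ : ImagTimeIdx M, ‖S (Ω 1).2 t₁ τ₁‖) * ∑ y ∈ Sy, w y * ‖Wp τ₀ τ₁ y‖ ≤ Ccol * B := by
    intro τ₀
    calc ∑ τ₁ : ImagTimeIdx M, (∑ t₁ : ImagTimeIdx M, ‖S (Ω 1).2 t₁ τ₁‖) * ∑ y ∈ Sy, w y * ‖Wp τ₀ τ₁ y‖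
        ≤ ∑ τ₁ : ImagTimeIdx M, Ccol * ∑ y ∈ Sy, w y * ‖Wp τ₀ τ₁ y‖ :=
          sum_le_sum fun τ₁ _ => mul_le_mul_of_nonneg_right (hcol _ τ₁) (sum_nonneg fun y _ => mul_nonneg (hw y) (norm_nonneg _))
      _ = Ccol * ∑ τ₁ : ImagTimeIdx M, ∑ y ∈ Sy, w y * ‖Wp τ₀ τ₁ y‖ := by rw [mul_sum]
      _ ≤ Ccol * B := mul_le_mul_of_nonneg_left (by simpa only [hWp] using hB τ₀) hCcol
  calc ∑ τ₀ : ImagTimeIdx M, ‖S (Ω 0).2 o.1 τ₀‖ * ∑ τ₁ : ImagTimeIdx M, (∑ t₁ : ImagTimeIdx M, ‖S (Ω 1).2 t₁ τ₁‖) * ∑ y ∈ Sy, w y * ‖Wp τ₀ τ₁ y‖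
      ≤ ∑ τ₀ : ImagTimeIdx M, ‖S (Ω 0).2 o.1 τ₀‖ * (Ccol * B) :=
        sum_le_sum fun τ₀ _ => mul_le_mul_of_nonneg_left (h3 τ₀) (norm_nonneg _)
    _ = (∑ τ₀ : ImagTimeIdx M, ‖S (Ω 0).2 o.1 τ₀‖) * (Ccol * B) := by rw [sum_mul]
    _ ≤ Crow * (Ccol * B) := mul_le_mul_of_nonneg_right (hrow _ _) (by positivity)
    _ = Crow * Ccol * B := by ring

end Summit.HubbardSuperconductivity.HubbardSuperconductivity.Theorems.TwoVolumeSource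

end
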